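import Mathlib
import HarnessLib

/-!
# Format C / A′: the JOINT shift bound from a torus sum of squares (transfer principle)

Helper file (`--supports stmt-RiemannHypothesis-0098`, lead-track anchor; infrastructure for the
Weil-positivity window ladder, format C far bound), RH-free.  Seat rh-explicit-weil-1 (phantom-ripple
format; cell memo `run/shared/lean/pub/rh-explicit/rh-explicit-weil-1/WEIL1-SIZELAW.md` §1/§5 and
`WEIL3-STRUCTURE.md` §9.5–9.6, kernel route K2).

The prime part of Weil's functional on real test functions supported in `[-a, a]` is
`-Σ_n (Λ(n)/√n) · 2 I_f(log n)`, `I_f(u) = ∫ f(x-u) f(x) dx` (`WeilFormatCShiftFormBound.lean` bounds ONE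
shift by the path-graph constant).  A JOINT bound `Σ_n 2Λ(n)/√n · I_f(log n) ≤ D · ∫ f²` follows from a
SUM-OF-SQUARES identity on the torus of the prime angles — WITHOUT Fourier analysis and without
Kronecker's theorem — by the following transfer principle.  Let `ℓ ∈ ℝ^k` (the logarithms of the primes),
`S_β ∈ ℤ^k` (`β < m`, the Gram monomials) and real rows `R_i ∈ ℝ^m` (`i < r`).  Then pointwise
`Σ_{α,β} (RᵀR)_{αβ} f(x − S_α·ℓ) f(x − S_β·ℓ) = Σ_i (Σ_β R_{iβ} f(x − S_β·ℓ))² ≥ 0`; integrating and using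
translation invariance, `0 ≤ Σ_γ g(γ) I_f(γ·ℓ)` where `g(γ) = Σ_{S_β − S_α = γ} (RᵀR)_{αβ}` are the
autocorrelation coefficients of the rows (`shiftCorr_gram_nonneg`, `sum_gramCoeff_mul_shiftCorr_nonneg`).
Since `I_f(u) = 0` for `|u| > 2a` (PHANTOM frequencies are invisible on the window,
`shiftCorr_eq_zero_of_lt_abs`) and `|I_f(u)| ≤ I_f(0) = ∫ f²` (`abs_shiftCorr_le`), any target weights `t`
obey

* `WeilFormatC.sum_mul_shiftCorr_le_of_sos` —
  **`Σ_{γ∈Γ} t(γ) I_f(γ·ℓ) ≤ (g(0) + Σ_{γ∈Γ∖{0}, γ not admissible} |t(γ) + g(γ)|) · ∫ f²`**,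
  where "admissible" is any finite set of `γ` with `2a < |γ·ℓ|`.

With `t` = the prime weights on `±e(n)` (so the left side is `Σ_n 2Λ(n)/√n · I_f(log n)`) and `R` an
integer SOS certificate this is the constant `D` that replaces the path-graph `A_op⁺` in the hypothesis
`hP` of `WeilFormatC.farBlock_ge_diag`; the kernel checker and the data live in sibling files.
Standard axioms only; nothing is assumed.
-/

set_option linter.dupNamespace false

noncomputable section

open MeasureTheory Set Finset
open scoped Real BigOperators

namespace Summit.RiemannHypothesis.RiemannHypothesis.Theorems.WeilFormatC

/- To stay in the kernel-reviewed lane this file declares NO definitions: the shift correlation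
`I_f(u) = ∫ f(x − u) f(x) dx`, the frequency `γ·ℓ = Σ_j γ_j ℓ_j` of an exponent vector and the Gram coefficient
`g(γ) = Σ_{α,β : S_β − S_α = γ} Σ_i R_{iα} R_{iβ}` are written out in full everywhere. -/

/-! ### The frequency map is additive -/

/-- `(β − α)·ℓ = β·ℓ − α·ℓ`. [folklore] -/
theorem latFreq_sub {k : ℕ} (ℓ : Fin k → ℝ) (β α : Fin k → ℤ) :
    (∑ j, ((β - α) j : ℝ) * ℓ j) = (∑ j, ((β) j : ℝ) * ℓ j) - (∑ j, ((α) j : ℝ) * ℓ j) := by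
  rw [← Finset.sum_sub_distrib]
  refine Finset.sum_congr rfl fun j _ ↦ ?_
  simp only [Pi.sub_apply, Int.cast_sub]
  ring

/-- `0·ℓ = 0`. [folklore] -/
theorem latFreq_zero {k : ℕ} (ℓ : Fin k → ℝ) : (∑ j, ((0 : Fin k → ℤ) j : ℝ) * ℓ j) = 0 := by
  simp

/-- `(−γ)·ℓ = −(γ·ℓ)`. [folklore] -/
theorem latFreq_neg {k : ℕ} (ℓ : Fin k → ℝ) (γ : Fin k → ℤ) : (∑ j, ((-γ) j : ℝ) * ℓ j) = -(∑ j, ((γ) j : ℝ) * ℓ j) := by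
  have h := latFreq_sub ℓ 0 γ
  rwa [zero_sub, latFreq_zero, zero_sub] at h

section Window

variable {f : ℝ → ℝ} {C a : ℝ}

/-- A bounded measurable function vanishing off `[−a, a]`: its shifted products are integrable. -/
theorem integrable_shift_mul_shift (hf : Measurable f) (hC : ∀ x, |f x| ≤ C)
    (hsupp : ∀ x, x ∉ Icc (-a) a → f x = 0) (u v : ℝ) :
    Integrable (fun x ↦ f (x - u) * f (x - v)) := by
  have hC0 : 0 ≤ C := le_trans (abs_nonneg _) (hC 0)
  have hmeas : Measurable fun x ↦ f (x - u) * f (x - v) :=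
    (hf.comp (measurable_id.sub_const u)).mul (hf.comp (measurable_id.sub_const v))
  have hvol : volume (Icc (-a + v) (a + v)) ≠ ⊤ := by
    rw [Real.volume_Icc]; exact ENNReal.ofReal_ne_top
  have hg : Integrable ((Icc (-a + v) (a + v)).indicator fun _ : ℝ ↦ C * C) :=
    (integrable_indicator_iff measurableSet_Icc).2 (integrableOn_const hvol)
  refine Integrable.mono' hg hmeas.aestronglyMeasurable (Filter.Eventually.of_forall fun x ↦ ?_)
  by_cases hx : x ∈ Icc (-a + v) (a + v)
  · rw [Set.indicator_of_mem hx, Real.norm_eq_abs, abs_mul]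
    exact mul_le_mul (hC _) (hC _) (abs_nonneg _) hC0
  · have hxv : x - v ∉ Icc (-a) a := fun h ↦ hx ⟨by linarith [h.1], by linarith [h.2]⟩
    rw [Set.indicator_of_notMem hx, hsupp _ hxv, mul_zero, norm_zero]

/-- `∫ f(x − u) f(x − v) dx = I_f(u − v)` (translation invariance). -/
theorem integral_shift_mul_shift_eq_corr (f : ℝ → ℝ) (u v : ℝ) :
    ∫ x, f (x - u) * f (x - v) = (∫ x, f (x - (u - v)) * f x) := by
  have h := MeasureTheory.integral_sub_right_eq_self (μ := volume)
    (fun y ↦ f (y - (u - v)) * f y) v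
  rw [← h]
  refine integral_congr_ae (Filter.Eventually.of_forall fun x ↦ ?_)
  simp only
  ring_nf

/-- `I_f` is even: `I_f(−u) = I_f(u)`. -/
theorem shiftCorr_neg (f : ℝ → ℝ) (u : ℝ) : (∫ x, f (x - (-u)) * f x) = (∫ x, f (x - (u)) * f x) := by
  have h := integral_shift_mul_shift_eq_corr f 0 u
  simp only [sub_zero, zero_sub] at h
  rw [← h]
  refine integral_congr_ae (Filter.Eventually.of_forall fun x ↦ ?_)
  simp only
  ring

/-- `I_f(0) = ∫ f²`. -/
theorem shiftCorr_zero (f : ℝ → ℝ) : (∫ x, f (x - (0)) * f x) = ∫ x, f x ^ 2 := by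
  refine integral_congr_ae (Filter.Eventually.of_forall fun x ↦ ?_)
  simp only [sub_zero]
  ring

/-- `|I_f(u)| ≤ ∫ f²` (`2|pq| ≤ p² + q²` pointwise, then translation invariance). -/
theorem abs_shiftCorr_le (hf : Measurable f) (hC : ∀ x, |f x| ≤ C)
    (hsupp : ∀ x, x ∉ Icc (-a) a → f x = 0) (u : ℝ) :
    |(∫ x, f (x - (u)) * f x)| ≤ ∫ x, f x ^ 2 := by
  have hi0 := integrable_shift_mul_shift hf hC hsupp u 0
  have hiu := integrable_shift_mul_shift hf hC hsupp u u
  have hi00 := integrable_shift_mul_shift hf hC hsupp 0 0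
  simp only [sub_zero] at hi0 hi00
  have hsq : ∀ y, f y * f y = f y ^ 2 := fun y ↦ by ring
  have hiu' : Integrable fun x ↦ f (x - u) ^ 2 := by
    refine hiu.congr (Filter.Eventually.of_forall fun x ↦ ?_); simp only [hsq]
  have hi00' : Integrable fun x ↦ f x ^ 2 := by
    refine hi00.congr (Filter.Eventually.of_forall fun x ↦ ?_); simp only [hsq]
  -- `∫ f(x-u)² = ∫ f²`
  have htr : ∫ x, f (x - u) ^ 2 = ∫ x, f x ^ 2 :=
    MeasureTheory.integral_sub_right_eq_self (μ := volume) (fun y ↦ f y ^ 2) u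
  -- `2|∫ g| ≤ ∫ (f(x-u)² + f²)`
  have hup : (∫ x, f (x - (u)) * f x) ≤ ∫ x, f x ^ 2 := by
    have hle : ∀ x, f (x - u) * f x ≤ (f (x - u) ^ 2 + f x ^ 2) / 2 := fun x ↦ by
      nlinarith [sq_nonneg (f (x - u) - f x)]
    calc (∫ x, f (x - (u)) * f x) = ∫ x, f (x - u) * f x := rfl
      _ ≤ ∫ x, (f (x - u) ^ 2 + f x ^ 2) / 2 :=
          integral_mono hi0 ((hiu'.add hi00').div_const 2) hle
      _ = ((∫ x, f (x - u) ^ 2) + ∫ x, f x ^ 2) / 2 := by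
          rw [MeasureTheory.integral_div, integral_add hiu' hi00']
      _ = ∫ x, f x ^ 2 := by rw [htr]; ring
  have hlo : -(∫ x, f x ^ 2) ≤ (∫ x, f (x - (u)) * f x) := by
    have hle : ∀ x, -((f (x - u) ^ 2 + f x ^ 2) / 2) ≤ f (x - u) * f x := fun x ↦ by
      nlinarith [sq_nonneg (f (x - u) + f x)]
    calc -(∫ x, f x ^ 2) = -(((∫ x, f (x - u) ^ 2) + ∫ x, f x ^ 2) / 2) := by rw [htr]; ring
      _ = ∫ x, -((f (x - u) ^ 2 + f x ^ 2) / 2) := by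
          rw [integral_neg, MeasureTheory.integral_div, integral_add hiu' hi00']
      _ ≤ ∫ x, f (x - u) * f x := integral_mono ((hiu'.add hi00').div_const 2).neg hi0 hle
      _ = (∫ x, f (x - (u)) * f x) := rfl
  exact abs_le.2 ⟨hlo, hup⟩

/-- **Phantom frequencies are invisible on the window**: `2a < |u|` gives `I_f(u) = 0`. -/
theorem shiftCorr_eq_zero_of_lt_abs (hsupp : ∀ x, x ∉ Icc (-a) a → f x = 0) {u : ℝ}
    (hu : 2 * a < |u|) : (∫ x, f (x - (u)) * f x) = 0 := by
  refine (integral_congr_ae (Filter.Eventually.of_forall fun x ↦ ?_)).trans (integral_zero ℝ ℝ)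
  by_cases hx : x ∈ Icc (-a) a
  · have hxu : x - u ∉ Icc (-a) a := by
      intro h
      have h1 := hx.1; have h2 := hx.2; have h3 := h.1; have h4 := h.2
      have : |u| ≤ 2 * a := abs_le.2 ⟨by linarith, by linarith⟩
      linarith
    rw [hsupp _ hxu, zero_mul]
  · rw [hsupp _ hx, mul_zero]

end Window

/-! ### The sum-of-squares transfer -/

section SOS

variable {k m r : ℕ} {f : ℝ → ℝ} {C a : ℝ}

/-- Pointwise sum of squares: `Σ_{α,β} (RᵀR)_{αβ} u_α u_β = Σ_i (Σ_β R_{iβ} u_β)²`. -/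
theorem sum_sum_gram_mul_eq_sum_sq (R : Fin r → Fin m → ℝ) (u : Fin m → ℝ) :
    ∑ α, ∑ β, (∑ i, R i α * R i β) * (u α * u β) = ∑ i, (∑ β, R i β * u β) ^ 2 := by
  have h : ∀ i : Fin r, (∑ β, R i β * u β) ^ 2 = ∑ α, ∑ β, R i α * R i β * (u α * u β) := by
    intro i
    calc (∑ β, R i β * u β) ^ 2 = (∑ α, R i α * u α) * ∑ β, R i β * u β := sq _
      _ = ∑ α, R i α * u α * ∑ β, R i β * u β := Finset.sum_mul _ _ _
      _ = ∑ α, ∑ β, R i α * R i β * (u α * u β) := by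
          refine Finset.sum_congr rfl fun α _ ↦ ?_
          rw [Finset.mul_sum]
          exact Finset.sum_congr rfl fun β _ ↦ by ring
  simp_rw [h]
  calc ∑ α, ∑ β, (∑ i, R i α * R i β) * (u α * u β)
      = ∑ α, ∑ β, ∑ i, R i α * R i β * (u α * u β) := by
        refine Finset.sum_congr rfl fun α _ ↦ Finset.sum_congr rfl fun β _ ↦ ?_
        rw [Finset.sum_mul]
    _ = ∑ α, ∑ i, ∑ β, R i α * R i β * (u α * u β) := by
        refine Finset.sum_congr rfl fun α _ ↦ ?_
        exact Finset.sum_comm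
    _ = ∑ i, ∑ α, ∑ β, R i α * R i β * (u α * u β) := Finset.sum_comm

/-- **Gram positivity of the shift correlations**: for any real rows `R`,
`0 ≤ Σ_{α,β} (RᵀR)_{αβ} I_f(S_β·ℓ − S_α·ℓ)`. -/
theorem shiftCorr_gram_nonneg (ℓ : Fin k → ℝ) (S : Fin m → Fin k → ℤ) (R : Fin r → Fin m → ℝ)
    (hf : Measurable f) (hC : ∀ x, |f x| ≤ C) (hsupp : ∀ x, x ∉ Icc (-a) a → f x = 0) :
    0 ≤ ∑ α, ∑ β, (∑ i, R i α * R i β) * (∫ x, f (x - ((∑ j, ((S β - S α) j : ℝ) * ℓ j))) * f x) := by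
  -- each correlation is the integral of a shifted product
  have hI : ∀ α β : Fin m, (∫ x, f (x - ((∑ j, ((S β - S α) j : ℝ) * ℓ j))) * f x) =
      ∫ x, f (x - (∑ j, ((S β) j : ℝ) * ℓ j)) * f (x - (∑ j, ((S α) j : ℝ) * ℓ j)) := by
    intro α β
    rw [integral_shift_mul_shift_eq_corr, latFreq_sub]
  simp_rw [hI]
  have hint : ∀ α β : Fin m, Integrable fun x ↦ f (x - (∑ j, ((S β) j : ℝ) * ℓ j)) * f (x - (∑ j, ((S α) j : ℝ) * ℓ j)) :=
    fun α β ↦ integrable_shift_mul_shift hf hC hsupp _ _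
  -- pull the finite sums inside the integral
  have h1 : ∑ α, ∑ β, (∑ i, R i α * R i β) *
        ∫ x, f (x - (∑ j, ((S β) j : ℝ) * ℓ j)) * f (x - (∑ j, ((S α) j : ℝ) * ℓ j)) =
      ∫ x, ∑ α, ∑ β, (∑ i, R i α * R i β) *
        (f (x - (∑ j, ((S β) j : ℝ) * ℓ j)) * f (x - (∑ j, ((S α) j : ℝ) * ℓ j))) := by
    rw [integral_finsetSum _ (fun α _ ↦ ?_)]
    · refine Finset.sum_congr rfl fun α _ ↦ ?_
      rw [integral_finsetSum _ (fun β _ ↦ ?_)]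
      · refine Finset.sum_congr rfl fun β _ ↦ ?_
        rw [integral_const_mul]
      · exact (hint α β).const_mul _
    · exact integrable_finsetSum _ fun β _ ↦ (hint α β).const_mul _
  rw [h1]
  refine integral_nonneg fun x ↦ ?_
  have hx := sum_sum_gram_mul_eq_sum_sq R (fun β ↦ f (x - (∑ j, ((S β) j : ℝ) * ℓ j)))
  have hcomm : ∑ α, ∑ β, (∑ i, R i α * R i β) *
      (f (x - (∑ j, ((S β) j : ℝ) * ℓ j)) * f (x - (∑ j, ((S α) j : ℝ) * ℓ j))) =
      ∑ α, ∑ β, (∑ i, R i α * R i β) *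
      (f (x - (∑ j, ((S α) j : ℝ) * ℓ j)) * f (x - (∑ j, ((S β) j : ℝ) * ℓ j))) := by
    refine Finset.sum_congr rfl fun α _ ↦ Finset.sum_congr rfl fun β _ ↦ by ring
  simp only
  rw [hcomm, hx]
  exact Finset.sum_nonneg fun i _ ↦ sq_nonneg _

/-- Regrouping a Gram double sum by frequency: for any `X : ℤ^k → ℝ` and a finite set `Γ` containing
all differences `S_β − S_α`, `Σ_{γ∈Γ} g(γ) X(γ) = Σ_{α,β} (RᵀR)_{αβ} X(S_β − S_α)`. -/
theorem sum_gramCoeff_mul_eq (S : Fin m → Fin k → ℤ) (R : Fin r → Fin m → ℝ)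
    (Γ : Finset (Fin k → ℤ)) (hΓ : ∀ α β, S β - S α ∈ Γ) (X : (Fin k → ℤ) → ℝ) :
    ∑ γ ∈ Γ, (∑ α', ∑ β', if S β' - S α' = (γ) then ∑ i, R i α' * R i β' else (0 : ℝ)) * X γ = ∑ α, ∑ β, (∑ i, R i α * R i β) * X (S β - S α) := by
  have h1 : ∑ γ ∈ Γ, (∑ α, ∑ β, if S β - S α = γ then ∑ i, R i α * R i β else 0) * X γ =
      ∑ γ ∈ Γ, ∑ α, ∑ β, (if S β - S α = γ then ∑ i, R i α * R i β else 0) * X γ := by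
    refine Finset.sum_congr rfl fun γ _ ↦ ?_
    rw [Finset.sum_mul]
    refine Finset.sum_congr rfl fun α _ ↦ ?_
    rw [Finset.sum_mul]
  rw [h1, Finset.sum_comm]
  refine Finset.sum_congr rfl fun α _ ↦ ?_
  rw [Finset.sum_comm]
  refine Finset.sum_congr rfl fun β _ ↦ ?_
  rw [Finset.sum_eq_single (S β - S α)]
  · rw [if_pos rfl]
  · intro γ _ hne
    rw [if_neg (Ne.symm hne), zero_mul]
  · intro h
    exact absurd (hΓ α β) h

/-- `0 ≤ Σ_{γ∈Γ} g(γ) I_f(γ·ℓ)`. -/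
theorem sum_gramCoeff_mul_shiftCorr_nonneg (ℓ : Fin k → ℝ) (S : Fin m → Fin k → ℤ)
    (R : Fin r → Fin m → ℝ) (hf : Measurable f) (hC : ∀ x, |f x| ≤ C)
    (hsupp : ∀ x, x ∉ Icc (-a) a → f x = 0) (Γ : Finset (Fin k → ℤ))
    (hΓ : ∀ α β, S β - S α ∈ Γ) :
    0 ≤ ∑ γ ∈ Γ, (∑ α', ∑ β', if S β' - S α' = (γ) then ∑ i, R i α' * R i β' else (0 : ℝ)) * (∫ x, f (x - ((∑ j, ((γ) j : ℝ) * ℓ j))) * f x) := by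
  rw [sum_gramCoeff_mul_eq S R Γ hΓ]
  exact shiftCorr_gram_nonneg ℓ S R hf hC hsupp

/-- **The joint shift bound from a torus SOS certificate (transfer principle).**  Rows `R` on monomials
`S`, frequencies `ℓ`, a finite `Γ ∋ 0` containing all `S_β − S_α`, target weights `t` with `t(0) = 0`, and
a finite set `adm` of ADMISSIBLE frequencies (`2a < |γ·ℓ|`).  For every real measurable bounded `f`
vanishing off `[−a, a]`:
`Σ_{γ∈Γ} t(γ) I_f(γ·ℓ) ≤ (g(0) + Σ_{γ ∈ (Γ∖{0})∖adm} |t(γ) + g(γ)|) · ∫ f²`. -/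
theorem sum_mul_shiftCorr_le_of_sos (ℓ : Fin k → ℝ) (S : Fin m → Fin k → ℤ) (R : Fin r → Fin m → ℝ)
    (hf : Measurable f) (hC : ∀ x, |f x| ≤ C) (hsupp : ∀ x, x ∉ Icc (-a) a → f x = 0)
    (Γ : Finset (Fin k → ℤ)) (hΓ : ∀ α β, S β - S α ∈ Γ) (h0 : (0 : Fin k → ℤ) ∈ Γ)
    (t : (Fin k → ℤ) → ℝ) (ht : t 0 = 0) (adm : Finset (Fin k → ℤ))
    (hadm : ∀ γ ∈ adm, 2 * a < |(∑ j, ((γ) j : ℝ) * ℓ j)|) :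
    ∑ γ ∈ Γ, t γ * (∫ x, f (x - ((∑ j, ((γ) j : ℝ) * ℓ j))) * f x) ≤
      ((∑ α', ∑ β', if S β' - S α' = (0) then ∑ i, R i α' * R i β' else (0 : ℝ)) + ∑ γ ∈ (Γ.erase 0) \ adm, |t γ + (∑ α', ∑ β', if S β' - S α' = (γ) then ∑ i, R i α' * R i β' else (0 : ℝ))|) * ∫ x, f x ^ 2 := by
  -- abstract the Gram coefficients `g` and the correlations `X`
  obtain ⟨g, hg⟩ : ∃ g : (Fin k → ℤ) → ℝ, ∀ γ, g γ = (∑ α', ∑ β', if S β' - S α' = (γ) then ∑ i, R i α' * R i β' else (0 : ℝ)) := ⟨_, fun _ ↦ rfl⟩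
  obtain ⟨X, hX⟩ : ∃ X : (Fin k → ℤ) → ℝ, ∀ γ, X γ = (∫ x, f (x - ((∑ j, ((γ) j : ℝ) * ℓ j))) * f x) := ⟨_, fun _ ↦ rfl⟩
  have hpos : 0 ≤ ∑ γ ∈ Γ, g γ * X γ := by
    have h := sum_gramCoeff_mul_shiftCorr_nonneg ℓ S R hf hC hsupp Γ hΓ
    simpa only [← hg, ← hX] using h
  have hE : 0 ≤ ∫ x, f x ^ 2 := integral_nonneg fun x ↦ sq_nonneg _
  have hX0 : X 0 = ∫ x, f x ^ 2 := by
    rw [hX]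
    simp only [Pi.zero_apply, Int.cast_zero, zero_mul, Finset.sum_const_zero]
    exact shiftCorr_zero f
  have hXle : ∀ γ, |X γ| ≤ ∫ x, f x ^ 2 := fun γ ↦ by rw [hX]; exact abs_shiftCorr_le hf hC hsupp _
  have hXadm : ∀ γ ∈ adm, X γ = 0 := fun γ hγ ↦ by
    rw [hX]; exact shiftCorr_eq_zero_of_lt_abs hsupp (hadm γ hγ)
  -- restate the goal through `g`, `X`
  simp only [← hg, ← hX]
  -- `Σ t X ≤ Σ (t + g) X`
  have h1 : ∑ γ ∈ Γ, t γ * X γ ≤ ∑ γ ∈ Γ, (t γ + g γ) * X γ := by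
    have : ∑ γ ∈ Γ, (t γ + g γ) * X γ = (∑ γ ∈ Γ, t γ * X γ) + ∑ γ ∈ Γ, g γ * X γ := by
      rw [← Finset.sum_add_distrib]
      refine Finset.sum_congr rfl fun γ _ ↦ by ring
    rw [this]
    linarith
  -- split off `γ = 0`, then the admissible ones
  have h2 : ∑ γ ∈ Γ, (t γ + g γ) * X γ =
      g 0 * X 0 + ∑ γ ∈ Γ.erase 0, (t γ + g γ) * X γ := by
    rw [← Finset.add_sum_erase Γ _ h0, ht, zero_add]
  have h3 : ∑ γ ∈ Γ.erase 0, (t γ + g γ) * X γ =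
      ∑ γ ∈ (Γ.erase 0) \ adm, (t γ + g γ) * X γ := by
    symm
    refine Finset.sum_subset Finset.sdiff_subset fun γ hγ hγ' ↦ ?_
    have hmem : γ ∈ adm := by
      by_contra h
      exact hγ' (Finset.mem_sdiff.2 ⟨hγ, h⟩)
    rw [hXadm γ hmem, mul_zero]
  have h4 : ∑ γ ∈ (Γ.erase 0) \ adm, (t γ + g γ) * X γ ≤
      ∑ γ ∈ (Γ.erase 0) \ adm, |t γ + g γ| * ∫ x, f x ^ 2 := by
    refine Finset.sum_le_sum fun γ _ ↦ ?_
    calc (t γ + g γ) * X γ ≤ |(t γ + g γ) * X γ| := le_abs_self _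
      _ = |t γ + g γ| * |X γ| := abs_mul _ _
      _ ≤ |t γ + g γ| * ∫ x, f x ^ 2 :=
          mul_le_mul_of_nonneg_left (hXle γ) (abs_nonneg _)
  calc ∑ γ ∈ Γ, t γ * X γ ≤ ∑ γ ∈ Γ, (t γ + g γ) * X γ := h1
    _ = g 0 * X 0 + ∑ γ ∈ (Γ.erase 0) \ adm, (t γ + g γ) * X γ := by rw [h2, h3]
    _ ≤ g 0 * (∫ x, f x ^ 2) + ∑ γ ∈ (Γ.erase 0) \ adm, |t γ + g γ| * ∫ x, f x ^ 2 := by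
        rw [hX0]; exact add_le_add le_rfl h4
    _ = (g 0 + ∑ γ ∈ (Γ.erase 0) \ adm, |t γ + g γ|) * ∫ x, f x ^ 2 := by
        rw [add_mul, Finset.sum_mul]

end SOS

/-! ### From whole-line to window integrals -/

section Interval

variable {f : ℝ → ℝ} {C a : ℝ}

/-- For `f` vanishing off `[−a, a]` (`−a ≤ a`), the whole-line shift correlation is the window integral
`∫_{−a}^{a} f(x − u) f(x) dx`. -/
theorem shiftCorr_eq_intervalIntegral (hsupp : ∀ x, x ∉ Icc (-a) a → f x = 0) (ha : -a ≤ a) (u : ℝ) :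
    (∫ x, f (x - (u)) * f x) = ∫ x in (-a)..a, f (x - u) * f x := by
  rw [intervalIntegral.integral_of_le ha, ← integral_Icc_eq_integral_Ioc,
    setIntegral_eq_integral_of_forall_compl_eq_zero]
  intro x hx
  rw [hsupp x hx, mul_zero]

/-- Same for the energy: `∫ f² = ∫_{−a}^{a} f²`. -/
theorem integral_sq_eq_intervalIntegral (hsupp : ∀ x, x ∉ Icc (-a) a → f x = 0) (ha : -a ≤ a) :
    ∫ x, f x ^ 2 = ∫ x in (-a)..a, f x ^ 2 := by
  rw [intervalIntegral.integral_of_le ha, ← integral_Icc_eq_integral_Ioc,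
    setIntegral_eq_integral_of_forall_compl_eq_zero]
  intro x hx
  rw [hsupp x hx]; ring

end Interval

end Summit.RiemannHypothesis.RiemannHypothesis.Theorems.WeilFormatC
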